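import Mathlib
import Summits.Ventures.PercRepro2.TB14DomZFree

/-!
# Row 2′TB: the MONOTONE release moves — (DOM-Z, MONO) as a named tree statement
(blind cell PercRepro2, mine-c g22, 2026-08-26; `conjectures/MINE-C.md` §31.3)

A release move `y ↦ y'` (`TB14DomZ.IsReleaseMove`: the red cluster of `a₂` shrinks, `o` is
released, the colouring is unchanged off the star of the released part `Z`) is MONOTONE when it
creates no red edge inside the old cluster: on every edge with both ends in `C_red(a₂)(y)` the
target is dominated by the source (`y' e = true → y e = true`).  In words: the target is obtained
from the source by DELETING red edges inside the red cluster of `a₂` — a set whose removal cuts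
`o` off from `a₂` — and recolouring the edges between the cut-off part and the outside freely.
Census (own code `data/mine-c/g22/rigidity/rigid.c`, relation REL=14, mark-free): Hall's condition
for these moves has 0 failures on n = 5 (all 728 connected labelled graphs, 17,640 instances), n = 6
(all 26,704 graphs with m ≤ 12, 1,426,200 instances), n = 7 (all 499,782 graphs with m ≤ 9,
59,877,930 instances, 2,350,635,840 sources — kit j249277) and 1,906 random connected 8-vertex
graphs with m ≤ 12 (386,336 instances); the mirror restriction («old red interior edges stay red»)
fails at n = 5.  Every FORCED pair of the release Hall (a source with the same partner in
every perfect matching) is a monotone move.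

* `IsMonoReleaseMove`, `monoMoves`, `MonoHallAt`: the moves, the targets they reach, Hall;
* `monoMoves_subset_releaseMoves`, `releaseHallAt_of_monoHallAt`: fewer moves, Hall harder;
* `DomZReleaseMono` (a Prop, NOT a theorem — a candidate sharper than `DomZReleaseFree`),
  `DomZReleaseFree_of_mono`, `TB14_of_DomZReleaseMono`.
Own work; standard axioms.
-/

namespace Summit.Ventures.PercRepro2

namespace TB14DomZMono

open CovForm A3InactiveTyped TB14Fold TB14FlipFamily TB14Hall TB14DomZ TB14DomZFree

section Moves

variable {V : Type} {E : Type}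
variable (ends : E → Sym2 V) (a₂ : V)

/-- **A monotone release move** `y ↦ y'`: a release move that creates no red edge inside the old
red cluster of `a₂`. -/
structure IsMonoReleaseMove (o : V) (y y' : Config E) : Prop extends IsReleaseMove ends a₂ o y y' where
  /-- Inside `C_red(a₂)(y)` only red → blue. -/
  mono : ∀ e, (∀ x ∈ ends e, Conn ends y a₂ x) → y' e = true → y e = true

end Moves

section Hall

variable {V : Type} {E : Type} [Fintype E] [DecidableEq E]
variable (ends : E → Sym2 V) (a₁ a₂ b o : V) (F : Finset E)

open Classical in
/-- The monotone release moves of `y` that are targets of row 2′TB. -/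
noncomputable def monoMoves (y : Config E) : Finset (Config E) :=
  Finset.univ.filter fun y' => IsTgt ends a₁ a₂ b o F y' ∧ IsMonoReleaseMove ends a₂ o y y'

open Classical in
/-- **Hall's condition for the monotone release moves** at the profile `(F, z)` of one instance. -/
def MonoHallAt (z : Config E) : Prop :=
  ∀ S ⊆ srcSet ends a₁ a₂ b o F z, S.card ≤ (S.biUnion (monoMoves ends a₁ a₂ b o F)).card

open Classical in
/-- Every monotone release move is a release move. -/
theorem monoMoves_subset_releaseMoves (y : Config E) :
    monoMoves ends a₁ a₂ b o F y ⊆ releaseMoves ends a₁ a₂ b o F y := by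
  intro w hw
  rw [monoMoves, Finset.mem_filter] at hw
  rw [releaseMoves, Finset.mem_filter]
  exact ⟨hw.1, hw.2.1, hw.2.2.toIsReleaseMove⟩

open Classical in
/-- Hall for the monotone moves gives Hall for the release moves (fewer moves, the same sources). -/
theorem releaseHallAt_of_monoHallAt (z : Config E) (h : MonoHallAt ends a₁ a₂ b o F z) :
    ReleaseHallAt ends a₁ a₂ b o F z := by
  intro S hS
  refine (h S hS).trans (Finset.card_le_card ?_)
  intro x hx
  rw [Finset.mem_biUnion] at hx ⊢
  obtain ⟨y, hy, hxy⟩ := hx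
  exact ⟨y, hy, monoMoves_subset_releaseMoves ends a₁ a₂ b o F y hxy⟩

end Hall

/-- **(DOM-Z, MONO)** (a Prop, NOT a theorem — the candidate of MINE-C.md §31.3): on every finite
multigraph, for every roots `a₁ a₂` and bearer `o`, Hall's condition holds for the monotone release
moves of the mark-free sources at the all-free profile. -/
def DomZReleaseMono : Prop :=
  ∀ (V E : Type) [Fintype E] [DecidableEq E] (ends : E → Sym2 V) (a₁ a₂ o : V),
    MonoHallAt ends a₁ a₂ a₁ o Finset.univ (fun _ => false)

/-- The monotone form gives the mark-free release form. -/
theorem DomZReleaseFree_of_mono (h : DomZReleaseMono) : DomZReleaseFree :=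
  fun V E _ _ ends a₁ a₂ o =>
    releaseHallAt_of_monoHallAt ends a₁ a₂ a₁ o Finset.univ (fun _ => false) (h V E ends a₁ a₂ o)

/-- **Row 2′TB follows from (DOM-Z, MONO)** at every profile. -/
theorem TB14_of_DomZReleaseMono (R : Type*) [Field R] [LinearOrder R] [IsStrictOrderedRing R]
    (h : DomZReleaseMono) : TB14 R :=
  TB14_of_DomZReleaseFree R (DomZReleaseFree_of_mono h)

end TB14DomZMono

end Summit.Ventures.PercRepro2
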